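import Summits.QuantumFields.YangMills.Theorems.BalabanUVNodesN15DefectKernelVectorPieceDeriv
import HarnessLib

/-!
# Route «BalabanUVNodes» (K4 «SpineRates»), node N15 = NE2, THE -a ∕ -b INTERFACE OF THE BACKGROUND LAYER, part 13: THE ADJOINT-DERIVATIVE
# ENTRY OF THE VECTOR SINGLE-SCALE PIECE — `𝔇(H′C′(w′(∂′H′)ᵀ), HC(w(∂H)ᵀ))` in binder (a)'s format, the (3.42) THIRD ENTRY `G′∇*` of the piece

Cell `pub-ymgap`, seat `pub-ymgap-dag-n15-a` (KNIT-BY-NAME, generation g3; HUMAN RULING D-0062; chair R424 venue; `bears_on: R4∕N15`).  Filed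
`--supports stmt-QuantumFields-19351` (helper).  THEOREMS ONLY; imports BY NAME, nothing in the tree modified: part 9 `…DefectKernelVectorPiece` (this seat:
`norm_HkOp_le_tdistT`, `card_fibre_bondPair`, `kingBlockOf_bpt`), part 11 `…DefectKernelDHk163` (`hasMaj_idef_dhk163`, `rateD_nonneg`), part 8 (`hasMaj_idef_hk163`,
`norm_HkOp_kingPair_sub_le`), parts 1∕3∕4 (g2), `T4EtaRateDefect.idef_comp_majorant` (pv25), `B9SectDWeightedNeumann`, the b05 lineage (`HkOp`,
`B5Hk163TorusHolderDecay.norm_dker_bpt_le`), the t4-ne2∕b06 lineage `T4Cov2156Rate` (`cov2156_pair_torus`, `cov2156_rate_torus_king`).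

WHY.  [B9] (3.42)'s THIRD entry `|(G′∇*_Uλ)(x)|` for the single-scale piece: the right factor `K = Q_kG_k`-type transpose is replaced by the Riemann-weighted
TRANSPOSE OF THE DERIVATIVE kernel, `K = w·(∂_νH_k)ᵀ`, `K′ = (w∕(L^m)^{d+1})·(∂′_νH_{k+m})ᵀ` (entry binders `hK`, `hK′` against `D`, `D′`), the left factor
stays `H` (part 8 defect, b05 decay) and the middle factor is (2.156) as in part 9 — the transpose-symmetric twin of part 12, with part 4's transpose
mechanism fed by part 11's paired rate of `∂_νH_k`.  Every analytic input a tree theorem BY NAME.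

CONTENTS.  **`hasMaj_idef_vectorPieceAdjDeriv`**: `∃ B₀ C₁ δ′ > 0` such that for every unit torus (`L ∣ M_ν`, `d + 1 ≥ 2`, `L ≥ 1`), levels `k`, `m ≥ 1`,
direction `ν`, `0 ≤ α < 1`, `0 < γ < 1`: `𝔇(H′C′K′_D, HCK_D)` through (pull, pull) has the block majorant
`[nΩc₀c_r·(m₀ε_D + nΩR_Cc_r·a_D) + nΩR_Hc_r·m₀·a_D]·e^{−ρd}` with `ε_D = n_ηwR_D` (part 11), `a_D = n_ηwc_D`, `c_D = MD163·periodConst`,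
`c₀ = MG163·periodConst`, `R_H = C_H∕L^k` (part 8), `R_C = C₁L^{−k}`, `m₀ = nΩB₀c_r`; H-dominance at the halved rate `δ_H∕2`; window `ρ + σ_r ≤ δ`, `ρ + σ_r ≤ δ_C`.

HONEST FRAMING ∕ LIMITS.  `U = 1` linear theory on finite tori; entries 0∕1∕2 of the piece are now parts 9∕12∕13; the FOURTH entry `Δ_UG′` has NO
printed∕tree input and is NOT covered; count-neutral; NOT a discharge of N15; one finite T⁴ at fixed ε — NOT infinite volume, NOT OS on ℝ⁴, NOT a mass
gap, NOT Clay.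
-/

noncomputable section

open scoped BigOperators
open Finset

namespace Summit.QuantumFields.YangMills.BalabanUVNodes.N15.DefectKernel

open Literature.MathematicalPhysics.QuantumFieldTheory.Balaban1983to89
open Literature.MathematicalPhysics.QuantumFieldTheory.Balaban1983to89.B11SectG (BlockNorm HasMaj RowSum)
open Literature.MathematicalPhysics.QuantumFieldTheory.Balaban1983to89.T4EtaRateDefect (idef idef_comp_majorant slowWeight_const)
open Literature.MathematicalPhysics.QuantumFieldTheory.Balaban1983to89.T4EtaRateCoeffDefect (pull fibre mem_fibre)
open Literature.MathematicalPhysics.QuantumFieldTheory.Balaban1983to89.B9SectDWeightedNeumann (WRow wrow_of_exp hasMaj_comp_wrow)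
open Literature.MathematicalPhysics.QuantumFieldTheory.Balaban1983to89.B6RandomWalk (Triangle254)
open Literature.MathematicalPhysics.QuantumFieldTheory.Balaban1983to89.B4TorusKernel (periodConst)
open Literature.MathematicalPhysics.QuantumFieldTheory.Balaban1983to89.B5Prop11Plancherel (Tor fine)
open Literature.MathematicalPhysics.QuantumFieldTheory.Balaban1983to89.B5Block118 (bpt)
open Literature.MathematicalPhysics.QuantumFieldTheory.Balaban1983to89.B5Blocks16 (bpt_val bpt_bijective)
open Literature.MathematicalPhysics.QuantumFieldTheory.Balaban1983to89.B5Hk163Strip (kappa163 kappa163_pos)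
open Literature.MathematicalPhysics.QuantumFieldTheory.Balaban1983to89.B5Hk163Decay (MG163)
open Literature.MathematicalPhysics.QuantumFieldTheory.Balaban1983to89.B5Hk163Torus (HkOp norm_HkOp_le)
open Literature.MathematicalPhysics.QuantumFieldTheory.Balaban1983to89.B5Hk163TorusHolder (dker fdiff_HkOp_apply)
open Literature.MathematicalPhysics.QuantumFieldTheory.Balaban1983to89.B5Hk163TorusHolderDecay (MD163 norm_dker_bpt_le)
open Literature.MathematicalPhysics.QuantumFieldTheory.Balaban1983to89.B5Hk163RateSum (C0maj C1maj T163)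
open Literature.MathematicalPhysics.QuantumFieldTheory.Balaban1983to89.T4Hk163StripRate (CGe)
open Literature.MathematicalPhysics.QuantumFieldTheory.Balaban1983to89.B6LowerBound2153Torus (toT rep toT_rep)
open Literature.MathematicalPhysics.QuantumFieldTheory.Balaban1983to89.B6Lemma24Torus (pbox)
open Literature.MathematicalPhysics.QuantumFieldTheory.Balaban1983to89.B6BondEliminationTorus (pdist)
open Literature.MathematicalPhysics.QuantumFieldTheory.Balaban1983to89.B6Cov2156Torus (deltaPol bondReductionT one_le_M)
open Literature.MathematicalPhysics.QuantumFieldTheory.Balaban1983to89.T4Cov2156Rate (cov2156_pair_torus cov2156_rate_torus_king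
  bondDist_nonneg)
open Literature.MathematicalPhysics.QuantumFieldTheory.King1986 (exp_decay_mono aliasConst)
open Literature.MathematicalPhysics.QuantumFieldTheory.King1986.Torus (blockOf val_blockOf tdistT tdistT_symm tdistT_nonneg blockOf_over)

variable {d : ℕ}


/-! ## The assembly: the adjoint-derivative entry of the vector single-scale piece in binder (a)'s format -/

section Piece

/-- **THE ADJOINT-DERIVATIVE ENTRY OF THE VECTOR SINGLE-SCALE PIECE `𝔇(H′C′K′_D, HCK_D)` IN BINDER (a)'s FORMAT, EVERY ANALYTIC INPUT A TREE THEOREM**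
(`K_D = w·(∂_νH_k)ᵀ`; the (3.42) third entry `G′∇*` of the piece).  Part 9's assembly with the RIGHT pair the typed derivative `fdiff·HkOp` (entry binders
`hD`, `hD′`, `hK`, `hK′`; paired rate part 11, decay b05) and the H-dominance at the halved rate `δ_H∕2`.
[cite: King1986, (4.42)–(4.43) p.675 (mechanism), Prop. 3.8 (3.71) p.664 (second line, shape); Balaban1984PropagatorsI, (1.63) p.28; Balaban1984PropagatorsII, (2.156) p.250; Balaban1985BackgroundPropagators, (3.42) p.397 (third entry: the format's use)] -/
theorem hasMaj_idef_vectorPieceAdjDeriv (hd : 1 ≤ d) {L : ℕ} [NeZero L] (hL : 1 ≤ L) {α γ : ℝ} (hα0 : 0 ≤ α) (hα1 : α < 1)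
    (hγ0 : 0 < γ) (hγ1 : γ < 1) (ν : Fin (d + 1)) :
    ∃ B₀ C₁ δ' : ℝ, 0 < B₀ ∧ 0 < C₁ ∧ 0 < δ' ∧ ∀ (M : Fin (d + 1) → ℕ) [∀ μ, NeZero (M μ)] (_ : ∀ i, L ∣ M i)
      (k m : ℕ) (_ : 1 ≤ m)
      -- the carrier and the site assignments
      {g : B6.Geometry} [DecidableEq g.Site] (_ : Triangle254 g) (_ : ∀ y y' : g.Site, 0 ≤ g.dist y y')
      (_ : ∀ y y' : g.Site, g.dist y y' = g.dist y' y) {σr cr : ℝ} (_ : 0 ≤ σr) (_ : RowSum g σr cr)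
      (blkΩ : Tor M × Fin (d + 1) → g.Site) {nΩ : ℕ} (_ : ∀ y', (fibre blkΩ y').card ≤ nΩ)
      (blkη : Tor (fine (L ^ k) M) × Fin (d + 1) → g.Site) {nη : ℕ} (_ : ∀ y', (fibre blkη y').card ≤ nη)
      (pr : Tor (fine (L ^ m * L ^ k) M) → Tor (fine (L ^ k) M)) (_ : ∀ x' μ, (pr x' μ).val = (x' μ).val / L ^ m)
      (prV : Tor (fine (L ^ m * L ^ k) M) × Fin (d + 1) → Tor (fine (L ^ k) M) × Fin (d + 1))
      (_ : ∀ i, prV i = (pr i.1, i.2))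
      -- Bałaban's operators, read off by their entries
      (H : (Tor M × Fin (d + 1) → ℝ) →ₗ[ℝ] (Tor (fine (L ^ k) M) × Fin (d + 1) → ℝ))
      (_ : ∀ b i, H (Pi.single b 1) i = (HkOp (L ^ k) M i b).re)
      (H' : (Tor M × Fin (d + 1) → ℝ) →ₗ[ℝ] (Tor (fine (L ^ m * L ^ k) M) × Fin (d + 1) → ℝ))
      (_ : ∀ b i, H' (Pi.single b 1) i = (HkOp (L ^ m * L ^ k) M i b).re)
      (D : (Tor M × Fin (d + 1) → ℝ) →ₗ[ℝ] (Tor (fine (L ^ k) M) × Fin (d + 1) → ℝ))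
      (_ : ∀ b i, D (Pi.single b 1) i = ((B5Prop11Plancherel.fdiff (fine (L ^ k) M) ((L ^ k : ℕ) : ℂ) ν * HkOp (L ^ k) M) i b).re)
      (D' : (Tor M × Fin (d + 1) → ℝ) →ₗ[ℝ] (Tor (fine (L ^ m * L ^ k) M) × Fin (d + 1) → ℝ))
      (_ : ∀ b i, D' (Pi.single b 1) i =
        ((B5Prop11Plancherel.fdiff (fine (L ^ m * L ^ k) M) ((L ^ m * L ^ k : ℕ) : ℂ) ν * HkOp (L ^ m * L ^ k) M) i b).re)
      {w : ℝ} (_ : 0 ≤ w) (K : (Tor (fine (L ^ k) M) × Fin (d + 1) → ℝ) →ₗ[ℝ] (Tor M × Fin (d + 1) → ℝ))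
      (_ : ∀ i b, K (Pi.single i 1) b = w * D (Pi.single b 1) i)
      (K' : (Tor (fine (L ^ m * L ^ k) M) × Fin (d + 1) → ℝ) →ₗ[ℝ] (Tor M × Fin (d + 1) → ℝ))
      (_ : ∀ i' b, K' (Pi.single i' 1) b = w / ((L : ℝ) ^ m) ^ (d + 1) * D' (Pi.single b 1) i')
      (e : Tor M × Fin (d + 1) → B4.Idx (pbox M) (d + 1))
      (C : (Tor M × Fin (d + 1) → ℝ) →ₗ[ℝ] (Tor M × Fin (d + 1) → ℝ))
      (_ : ∀ b b', C (Pi.single b' 1) b = (bondReductionT L M (deltaPol M (L ^ k))).cov (e b) (e b'))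
      (C' : (Tor M × Fin (d + 1) → ℝ) →ₗ[ℝ] (Tor M × Fin (d + 1) → ℝ))
      (_ : ∀ b b', C' (Pi.single b' 1) b = (bondReductionT L M (deltaPol M (L ^ (k + m)))).cov (e b) (e b'))
      -- the two unit-torus dominances (the consumer's reading of its site assignments)
      {δ : ℝ} (_ : ∀ (b : Tor M × Fin (d + 1)) (i : Tor (fine (L ^ k) M) × Fin (d + 1)),
        δ * g.dist (blkΩ b) (blkη i) ≤ kappa163 (d + 1) / (d + 1) / 2 * tdistT M b.1 (blockOf (L ^ k) M i.1))
      {δC : ℝ} (_ : ∀ b b' : Tor M × Fin (d + 1),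
        δC * g.dist (blkΩ b) (blkΩ b') ≤ δ' * pdist M (one_le_M M) ((e b).1 : Fin (d + 1) → ℤ) ((e b').1 : Fin (d + 1) → ℤ))
      -- the rate window
      {ρ : ℝ} (_ : 0 ≤ ρ) (_ : ρ + σr ≤ δ) (_ : ρ + σr ≤ δC),
      HasMaj (BlockNorm.ofBlocks g blkη) (BlockNorm.ofBlocks g (blkη ∘ prV))
        (idef (pull prV) (pull prV) (H' ∘ₗ (C' ∘ₗ K')) (H ∘ₗ (C ∘ₗ K)))
        (fun y y' =>
          (nΩ * (MG163 (d + 1) * periodConst (kappa163 (d + 1)) d) * cr *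
              (nΩ * B₀ * cr *
                  (nη * w * ((2 ^ (1 - α) * (((d + 1 : ℕ) : ℝ) / ((L ^ k : ℕ) : ℝ)) ^ α *
                  (C0maj (d + 1) * (Real.pi * Real.pi ^ α) + C1maj (d + 1) * aliasConst (d + 1) α)
                + T163 (d + 1) 0 γ / ((L ^ k : ℕ) : ℝ) ^ γ) ^ (1 / 2 : ℝ)
              * (2 * (MD163 (d + 1) * periodConst (kappa163 (d + 1)) d)) ^ (1 / 2 : ℝ)))
                + nΩ * (C₁ * ((L : ℝ) ^ k)⁻¹) * cr * (nη * w * (MD163 (d + 1) * periodConst (kappa163 (d + 1)) d)))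
            + nΩ * ((CGe (d + 1) + (d + 1) * MD163 (d + 1)) * periodConst (kappa163 (d + 1)) d / ((L ^ k : ℕ) : ℝ)) * cr *
              (nΩ * B₀ * cr * (nη * w * (MD163 (d + 1) * periodConst (kappa163 (d + 1)) d)))) *
          Real.exp (-(ρ * g.dist y y'))) := by
  have hd1 : 2 ≤ d + 1 := by omega
  obtain ⟨B₀, δ₀, hB₀, hδ₀, HP⟩ := cov2156_pair_torus (d := d + 1) hd1 hL
  obtain ⟨C₁, δ₁, hC₁, hδ₁, HR⟩ := cov2156_rate_torus_king (d := d + 1) hd1 hL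
  refine ⟨B₀, C₁, min δ₀ δ₁, hB₀, hC₁, lt_min hδ₀ hδ₁, ?_⟩
  intro M _ hLM k m hm g _ htri hdist hsymm σr cr hσr hrow blkΩ nΩ hnΩ blkη nη hnη pr hpr prV hprV H hH H' hH' D hD D' hD'
    w hw0 K hK K' hK' e C hC C' hC' δ hdomH2 δC hdomC ρ hρ hρ₁ hρ₂
  -- the H-dominance at the full rate follows from the halved one
  have hdomH : ∀ (b : Tor M × Fin (d + 1)) (i : Tor (fine (L ^ k) M) × Fin (d + 1)),
      δ * g.dist (blkΩ b) (blkη i) ≤ kappa163 (d + 1) / (d + 1) * tdistT M b.1 (blockOf (L ^ k) M i.1) := fun b i =>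
    (hdomH2 b i).trans (by
      have := tdistT_nonneg M b.1 (blockOf (L ^ k) M i.1)
      have hκ : 0 ≤ kappa163 (d + 1) / (d + 1) := (div_pos (kappa163_pos _) (by positivity)).le
      nlinarith)
  -- names for the constants
  set c₀ : ℝ := MG163 (d + 1) * periodConst (kappa163 (d + 1)) d with hc₀def
  set RH : ℝ := (CGe (d + 1) + (d + 1) * MD163 (d + 1)) * periodConst (kappa163 (d + 1)) d / ((L ^ k : ℕ) : ℝ) with hRHdef
  set RC : ℝ := C₁ * ((L : ℝ) ^ k)⁻¹ with hRCdef
  set cD : ℝ := MD163 (d + 1) * periodConst (kappa163 (d + 1)) d with hcDdef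
  set RD : ℝ := ((2 ^ (1 - α) * (((d + 1 : ℕ) : ℝ) / ((L ^ k : ℕ) : ℝ)) ^ α *     (C0maj (d + 1) * (Real.pi * Real.pi ^ α) + C1maj (d + 1) * aliasConst (d + 1) α)   + T163 (d + 1) 0 γ / ((L ^ k : ℕ) : ℝ) ^ γ) ^ (1 / 2 : ℝ) * (2 * (MD163 (d + 1) * periodConst (kappa163 (d + 1)) d)) ^ (1 / 2 : ℝ)) with hRDdef
  have hcD : 0 ≤ cD := B5Hk163TorusHolderDecay.CdecD_nonneg (d := d)
  have hRD0 : 0 ≤ RD := mul_nonneg (Real.rpow_nonneg (rateD_nonneg (L ^ k) hα0 hα1 hγ0 hγ1 ν ν ν) _)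
    (Real.rpow_nonneg (mul_nonneg zero_le_two (B5Hk163TorusHolderDecay.CdecD_nonneg (d := d))) _)
  have hc₀ : 0 ≤ c₀ := by
    -- `c₀ = MG163·periodConst ≥ 0`: read off `norm_HkOp_le_tdistT` at any entry
    have h1 := (norm_nonneg _).trans (norm_HkOp_le_tdistT (L ^ k) M 0 0 (0 : Tor (fine (L ^ k) M)) (0 : Tor M))
    have hE := Real.exp_pos (-(kappa163 (d + 1) / (d + 1) * tdistT M (blockOf (L ^ k) M 0) 0))
    nlinarith
  have hRH0 : 0 ≤ RH := by
    -- `R_H ≥ 0`: read off part 8's rate theorem at any entry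
    have h1 := (norm_nonneg _).trans
      (norm_HkOp_kingPair_sub_le (L ^ m) (L ^ k) M pr hpr 0 0 (0 : Tor (fine (L ^ m * L ^ k) M)) (0 : Tor M))
    have hE := Real.exp_pos (-(kappa163 (d + 1) / (d + 1) * tdistT M (blockOf (L ^ m * L ^ k) M 0) 0))
    nlinarith
  have hRC0 : 0 ≤ RC := mul_nonneg hC₁.le (inv_nonneg.mpr (pow_nonneg (Nat.cast_nonneg _) _))
  have hnηw : 0 ≤ (nη : ℝ) * w := mul_nonneg (Nat.cast_nonneg _) hw0
  -- the H-legs: uniform decay (Theorem-3.3's role) in the carrier, from §1 and the H-dominance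
  have hdecH : ∀ (b : Tor M × Fin (d + 1)) (i : Tor (fine (L ^ k) M) × Fin (d + 1)),
      |H (Pi.single b 1) i| ≤ c₀ * Real.exp (-(δ * g.dist (blkΩ b) (blkη i))) := fun b i => by
    rw [hH]
    refine (Complex.abs_re_le_norm _).trans ((norm_HkOp_le_tdistT (L ^ k) M i.2 b.2 i.1 b.1).trans ?_)
    refine mul_le_mul_of_nonneg_left (Real.exp_le_exp.mpr ?_) hc₀
    have := hdomH b i
    rw [tdistT_symm] at this
    linarith
  have hdecH' : ∀ (b : Tor M × Fin (d + 1)) (i' : Tor (fine (L ^ m * L ^ k) M) × Fin (d + 1)),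
      |H' (Pi.single b 1) i'| ≤ c₀ * Real.exp (-(δ * g.dist (blkΩ b) (blkη (prV i')))) := fun b i' => by
    rw [hH']
    refine (Complex.abs_re_le_norm _).trans ((norm_HkOp_le_tdistT (L ^ m * L ^ k) M i'.2 b.2 i'.1 b.1).trans ?_)
    refine mul_le_mul_of_nonneg_left (Real.exp_le_exp.mpr ?_) hc₀
    have h1 := hdomH b (prV i')
    simp only [hprV] at h1
    rw [tdistT_symm, ← blockOf_over M (pr i'.1) i'.1 (hpr i'.1)] at h1
    simp only [hprV]
    linarith
  -- the D-leg (coarse): uniform decay of the derivative kernel (b05 `norm_dker_bpt_le`), in the carrier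
  have hdecD : ∀ (b : Tor M × Fin (d + 1)) (i : Tor (fine (L ^ k) M) × Fin (d + 1)),
      |D (Pi.single b 1) i| ≤ cD * Real.exp (-(δ * g.dist (blkΩ b) (blkη i))) := fun b i => by
    rw [hD]
    refine (Complex.abs_re_le_norm _).trans ((norm_dker_le_tdistT (L ^ k) M ν i.2 b.2 i.1 b.1).trans ?_)
    refine mul_le_mul_of_nonneg_left (Real.exp_le_exp.mpr ?_) hcD
    have := hdomH b i
    rw [tdistT_symm] at this
    linarith
  -- (i) the undifferenced COARSE adjoint factor `K`: `a_K·e^{−ρd}`, `a_K = n_η w c₀`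
  have hδρ : ρ ≤ δ := by linarith
  have hKmaj : HasMaj (BlockNorm.ofBlocks g blkη) (BlockNorm.ofBlocks g blkΩ) K
      (fun y y' => nη * w * cD * Real.exp (-((ρ + 0) * g.dist y y'))) := by
    have key := hasMaj_ofBlocks_of_entry_le blkη blkΩ (T := K)
      (κ := fun y y' => w * cD * Real.exp (-(ρ * g.dist y y')))
      (fun _ _ => mul_nonneg (mul_nonneg hw0 hcD) (Real.exp_nonneg _)) hnη fun b i => by
        rw [hK, abs_mul, abs_of_nonneg hw0, mul_assoc]
        refine mul_le_mul_of_nonneg_left ((hdecD b i).trans ?_) hw0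
        rw [hsymm]
        exact exp_decay_mono hcD hδρ (hdist _ _)
    refine key.mono fun y y' => le_of_eq ?_
    rw [add_zero]; ring
  have hKmaj' : HasMaj (BlockNorm.ofBlocks g blkη) (BlockNorm.ofBlocks g blkΩ) K
      (fun y y' => nη * w * cD * Real.exp (-(ρ * g.dist y y'))) := by
    simpa only [add_zero] using hKmaj
  -- (ii) the DEFECT of the adjoint factor (part 4's transpose mechanism + part 8's paired rate): `ε_K·e^{−ρd}·1`, `ε_K = n_η w R_H`
  have hw' : 0 ≤ w / ((L : ℝ) ^ m) ^ (d + 1) := div_nonneg hw0 (pow_nonneg (pow_nonneg (Nat.cast_nonneg _) _) _)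
  have hbal : ∀ i : Tor (fine (L ^ k) M) × Fin (d + 1), w / ((L : ℝ) ^ m) ^ (d + 1) * ((fibre prV i).card : ℝ) = w := by
    rintro ⟨x, μ⟩
    rw [card_fibre_bondPair pr prV hprV x μ]
    exact king_weight_balance L k m M pr hpr w x
  have hDK : HasMaj (BlockNorm.ofBlocks g blkη) (BlockNorm.ofBlocks g blkΩ) (idef (pull prV) LinearMap.id K' K)
      (fun y y' => nη * w * RD * Real.exp (-(ρ * g.dist y y')) * (fun _ : g.Site => (1 : ℝ)) y') := by
    have key := hasMaj_idef_transpose_of_pairedRate blkη blkΩ hnη prV hw0 hw' hK hK' hbal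
      (κ := fun y y' => RD * Real.exp (-(ρ * g.dist y y'))) (fun _ _ => mul_nonneg hRD0 (Real.exp_nonneg _))
      fun b i' => by
        have h1 := hdomH2 b (prV i')
        simp only [hprV] at h1 ⊢
        rw [tdistT_symm, ← blockOf_over M (pr i'.1) i'.1 (hpr i'.1)] at h1
        rw [hD', hD, ← Complex.sub_re]
        refine (Complex.abs_re_le_norm _).trans
          ((norm_dker_kingPair_sub_le (L ^ m) (L ^ k) M hα0 hα1 hγ0 hγ1 pr hpr i'.2 b.2 ν i'.1 b.1).trans ?_)
        refine mul_le_mul_of_nonneg_left (Real.exp_le_exp.mpr ?_) hRD0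
        have h2 : ρ * g.dist (blkΩ b) (blkη (pr i'.1, i'.2)) ≤ δ * g.dist (blkΩ b) (blkη (pr i'.1, i'.2)) :=
          mul_le_mul_of_nonneg_right hδρ (hdist _ _)
        linarith
    refine key.mono fun y y' => le_of_eq ?_
    ring
  -- (iii) the DEFECT of the covariance ((2.156) rate, identity pairing): `N_C·1`, `N_C = nΩ R_C e^{−δ_C d}`, `‖N_C‖_ρ ≤ nΩ R_C c_r`
  have hDC : HasMaj (BlockNorm.ofBlocks g blkΩ) (BlockNorm.ofBlocks g blkΩ) (idef LinearMap.id LinearMap.id C' C)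
      (fun y y' => nΩ * RC * Real.exp (-(δC * g.dist y y')) * (fun _ : g.Site => (1 : ℝ)) y') := by
    have key := hasMaj_idef_id_id_of_rate blkΩ hnΩ C' C (t := fun b b' =>
        pdist M (one_le_M M) ((e b).1 : Fin (d + 1) → ℤ) ((e b').1 : Fin (d + 1) → ℤ)) hRC0 hdomC fun b b' => by
      rw [hC', hC]
      exact (HR M hLM k m (e b) (e b')).trans
        (exp_decay_mono hRC0 (min_le_right _ _) (bondDist_nonneg (one_le_M M) _ _))
    exact key.mono fun y y' => le_of_eq (by rw [mul_one])
  have hNC_wrow : WRow g ρ (fun y y' => nΩ * RC * Real.exp (-(δC * g.dist y y'))) (nΩ * RC * cr) :=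
    wrow_of_exp hdist hrow (mul_nonneg (Nat.cast_nonneg _) hRC0) hρ₂
  -- (iv) the undifferenced covariances `C`, `C′`: `N₀ = nΩ B₀ e^{−δ_C d}`, `‖N₀‖_ρ ≤ nΩ B₀ c_r`
  have hCov : ∀ {kk : ℕ} {T : (Tor M × Fin (d + 1) → ℝ) →ₗ[ℝ] (Tor M × Fin (d + 1) → ℝ)},
      (∀ b b', T (Pi.single b' 1) b = (bondReductionT L M (deltaPol M (L ^ kk))).cov (e b) (e b')) →
      HasMaj (BlockNorm.ofBlocks g blkΩ) (BlockNorm.ofBlocks g blkΩ) T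
        (fun y y' => nΩ * (B₀ * Real.exp (-(δC * g.dist y y')))) := by
    intro kk T hT
    refine hasMaj_ofBlocks_of_entry_le blkΩ blkΩ (κ := fun y y' => B₀ * Real.exp (-(δC * g.dist y y')))
      (fun _ _ => mul_nonneg hB₀.le (Real.exp_nonneg _)) hnΩ fun b b' => ?_
    rw [hT]
    refine ((HP M hLM kk (e b) (e b')).1).trans ?_
    refine (exp_decay_mono hB₀.le (min_le_left δ₀ δ₁) (bondDist_nonneg (one_le_M M) _ _)).trans ?_
    exact mul_le_mul_of_nonneg_left (Real.exp_le_exp.mpr (by linarith [hdomC b b'])) hB₀.le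
  have hCmaj := hCov (kk := k) (T := C) hC
  have hC'maj := hCov (kk := k + m) (T := C') hC'
  have hN₀ : ∀ y y' : g.Site, 0 ≤ nΩ * (B₀ * Real.exp (-(δC * g.dist y y'))) := fun _ _ =>
    mul_nonneg (Nat.cast_nonneg _) (mul_nonneg hB₀.le (Real.exp_nonneg _))
  have hm₀ : WRow g ρ (fun y y' => nΩ * (B₀ * Real.exp (-(δC * g.dist y y')))) (nΩ * B₀ * cr) := by
    have h := wrow_of_exp (ρ := ρ) (θ := nΩ * B₀) (δ := δC) hdist hrow (mul_nonneg (Nat.cast_nonneg _) hB₀.le) hρ₂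
    exact h.mono fun y y' => le_of_eq (by ring)
  -- STEP 1: `𝔇(C′K′, CK) ≤ (m₀ ε_K + nΩ R_C c_r a_K)·e^{−ρd}`
  have step1 := idef_comp_majorant (b₁ := BlockNorm.ofBlocks g blkη) (b₂ := BlockNorm.ofBlocks g blkΩ)
    (b₂' := BlockNorm.ofBlocks g blkΩ) (b₃' := BlockNorm.ofBlocks g blkΩ)
    (τ₁ := pull prV) (τ₂ := LinearMap.id) (τ₃ := LinearMap.id) (T₁' := C') (T₂' := K') (T₁ := C) (T₂ := K)
    (w := fun _ => (1 : ℝ)) (σ := 0) (C := 1)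
    htri hρ (fun _ => zero_le_one) (slowWeight_const 1) zero_le_one (mul_nonneg hnηw hRD0)
    (mul_nonneg hnηw hcD) hN₀ hm₀ (fun y y' => mul_nonneg (mul_nonneg (Nat.cast_nonneg _) hRC0) (Real.exp_nonneg _))
    hNC_wrow hC'maj hDK hDC hKmaj
  -- (v) the undifferenced FINE factor `H′`: `nΩ c₀ e^{−δ d}`, `‖·‖_ρ ≤ nΩ c₀ c_r`
  have hH'maj : HasMaj (BlockNorm.ofBlocks g blkΩ) (BlockNorm.ofBlocks g (blkη ∘ prV)) H'
      (fun y y' => nΩ * (c₀ * Real.exp (-(δ * g.dist y y')))) :=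
    hasMaj_ofBlocks_of_entry_le blkΩ (blkη ∘ prV) (T := H') (κ := fun y y' => c₀ * Real.exp (-(δ * g.dist y y')))
      (fun _ _ => mul_nonneg hc₀ (Real.exp_nonneg _)) hnΩ fun i' b => by
        rw [Function.comp_apply, hsymm]
        exact hdecH' b i'
  have hH'wrow : WRow g ρ (fun y y' => nΩ * (c₀ * Real.exp (-(δ * g.dist y y')))) (nΩ * c₀ * cr) := by
    have h := wrow_of_exp (ρ := ρ) (θ := nΩ * c₀) (δ := δ) hdist hrow (mul_nonneg (Nat.cast_nonneg _) hc₀) hρ₁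
    exact h.mono fun y y' => le_of_eq (by ring)
  -- (vi) the DEFECT of `H` (part 8): `nΩ R_H e^{−δ d}·1`, `‖·‖_ρ ≤ nΩ R_H c_r`
  have hDH : HasMaj (BlockNorm.ofBlocks g blkΩ) (BlockNorm.ofBlocks g (blkη ∘ prV)) (idef LinearMap.id (pull prV) H' H)
      (fun y y' => nΩ * (RH * Real.exp (-(δ * g.dist y y'))) * (fun _ : g.Site => (1 : ℝ)) y') := by
    have key := hasMaj_idef_hk163 (L ^ m) (L ^ k) M blkΩ (blkη ∘ prV) hnΩ pr hpr prV hprV H hH H' hH' (δ := δ)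
      fun i' b => by
        have h1 := hdomH b (prV i')
        simp only [hprV] at h1
        rw [tdistT_symm, ← blockOf_over M (pr i'.1) i'.1 (hpr i'.1)] at h1
        rw [Function.comp_apply, hsymm]
        simp only [hprV]
        exact h1
    exact key.mono fun y y' => le_of_eq (by rw [hRHdef]; ring)
  have hDH_wrow : WRow g ρ (fun y y' => nΩ * (RH * Real.exp (-(δ * g.dist y y')))) (nΩ * RH * cr) := by
    have h := wrow_of_exp (ρ := ρ) (θ := nΩ * RH) (δ := δ) hdist hrow (mul_nonneg (Nat.cast_nonneg _) hRH0) hρ₁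
    exact h.mono fun y y' => le_of_eq (by ring)
  -- (vii) the undifferenced COARSE product `C∘K`: `1·m₀·a_K·e^{−ρd}`
  have hCK : HasMaj (BlockNorm.ofBlocks g blkη) (BlockNorm.ofBlocks g blkΩ) (C ∘ₗ K)
      (fun y y' => (BlockNorm.ofBlocks g blkΩ).κ * (nΩ * B₀ * cr) * (nη * w * cD) * Real.exp (-((ρ + 0) * g.dist y y'))) := by
    have h := hasMaj_comp_wrow htri hρ (mul_nonneg hnηw hcD) hN₀ hm₀ hCmaj hKmaj'
    simpa only [add_zero] using h
  have hκ : (BlockNorm.ofBlocks g blkΩ).κ = 1 := rfl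
  have hcr0 : 0 ≤ cr := le_trans (Finset.sum_nonneg fun _ _ => (Real.exp_pos _).le) (hrow (blkΩ (0, 0)))
  have hεCK : 0 ≤ (BlockNorm.ofBlocks g blkΩ).κ * (nΩ * B₀ * cr) * (nη * w * RD)
      + (BlockNorm.ofBlocks g blkΩ).κ * (nΩ * RC * cr) * (nη * w * cD) * 1 := by
    rw [hκ]
    have := mul_nonneg hnηw hRD0
    have := mul_nonneg hnηw hcD
    have := hB₀.le
    positivity
  have haCK : 0 ≤ (BlockNorm.ofBlocks g blkΩ).κ * (nΩ * B₀ * cr) * (nη * w * cD) := by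
    rw [hκ]
    have := mul_nonneg hnηw hcD
    have := hB₀.le
    positivity
  -- STEP 2: `𝔇(H′(C′K′), H(CK))`
  have step2 := idef_comp_majorant (b₁ := BlockNorm.ofBlocks g blkη) (b₂ := BlockNorm.ofBlocks g blkΩ)
    (b₂' := BlockNorm.ofBlocks g blkΩ) (b₃' := BlockNorm.ofBlocks g (blkη ∘ prV))
    (τ₁ := pull prV) (τ₂ := LinearMap.id) (τ₃ := pull prV) (T₁' := H') (T₂' := C' ∘ₗ K') (T₁ := H) (T₂ := C ∘ₗ K)
    (w := fun _ => (1 : ℝ)) (σ := 0) (C := 1)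
    htri hρ (fun _ => zero_le_one) (slowWeight_const 1) zero_le_one hεCK haCK
    (fun y y' => mul_nonneg (Nat.cast_nonneg _) (mul_nonneg hc₀ (Real.exp_nonneg _))) hH'wrow
    (fun y y' => mul_nonneg (Nat.cast_nonneg _) (mul_nonneg hRH0 (Real.exp_nonneg _))) hDH_wrow
    hH'maj step1 hDH hCK
  refine step2.mono fun y y' => le_of_eq ?_
  simp only [hκ]
  ring

end Piece

end Summit.QuantumFields.YangMills.BalabanUVNodes.N15.DefectKernel
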